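import Mathlib
import Summits.MatrixMultiplication.MatrixMultiplication.Theorems.FidelityWitnessesFidelityGapTwoSixExplicitRows

/-!
# `FidelityGapTwoSixExplicit` — Bessel for the rows and Lemma R (the structural certificate)

Part of the proof of `FidelityWitnesses.FidelityGapTwoSixExplicit` (stmt-MatrixMultiplication-14041); see
`FidelityWitnessesFidelityGapTwoSixExplicitDefs.lean` for the line of argument.  Here: a kernel element
sees at most half of its mass through the four rows of an orthonormal pair (Bessel in the block space),
`dim kerSpan = 8`, and LEMMA R: for `Y ≤ kerSpan` of dimension `≥ 6` and an orthonormal traceless pair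
`(h, k)`, the projection onto `Y` captures at least a third of the rows: `kerProj = P_Y + P_E` with
`dim E ≤ 2`, captured mass `2/3 + 2/3`, Bessel `≤ dim E / 2 ≤ 1`.  Exactly (`δ = 0`) this says that no
`10`-plane of `K` passes the `(210)` test unless `K ⊖ F = U ⊗ h`.
-/

noncomputable section

namespace Summit.MatrixMultiplication.MatrixMultiplication.Theorems.GapTwoSixExplicit

-- single-conjunct summit: the `Summit.<S>.<P>` prefix repeats `MatrixMultiplication` by design (D-0017)
set_option linter.dupNamespace false

open scoped BigOperators ComplexConjugate InnerProductSpace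
open Literature.Computability.AlgebraicComplexity Module

/-! ## Bessel: a kernel element sees at most half of its mass through the rows of an orthonormal pair -/

/-- The row pairing as an inner product in the `16`-dimensional block `U`-index-`(0,1)` space:
`⟪rowVec b v, y⟫ = ⟪b ⊗ δ_v, (block of y)⟫`. [folklore] -/
theorem inner_rowVec_eq_block (b : V8) (v : Fin 2) (y : V64) :
    ⟪rowVec b v, y⟫_ℂ
      = ⟪(WithLp.toLp 2 (fun t : (Fin 2 × P2) × Fin 2 => if t.2 = v then b t.1 else 0) :
            EuclideanSpace ℂ ((Fin 2 × P2) × Fin 2)),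
          (WithLp.toLp 2 (fun t : (Fin 2 × P2) × Fin 2 => y (((0, t.1.1), t.1.2), (1, t.2))) :
            EuclideanSpace ℂ ((Fin 2 × P2) × Fin 2))⟫_ℂ := by
  rw [inner_rowVec, PiLp.inner_apply]
  symm
  rw [Fintype.sum_prod_type_right, Finset.sum_eq_single v]
  · rw [Fintype.sum_prod_type]
    refine Finset.sum_congr rfl fun j _ => Finset.sum_congr rfl fun m _ => ?_
    simp [mul_comm]
  · intro v' _ hv'
    refine Finset.sum_eq_zero fun q _ => ?_
    simp [hv']
  · intro h; exact absurd (Finset.mem_univ _) h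

/-- Inner products on `V8` in coordinates. [folklore] -/
theorem inner_V8 (x y : V8) : ⟪x, y⟫_ℂ = ∑ q, conj (x q) * y q := by
  simp only [PiLp.inner_apply, RCLike.inner_apply']

/-- **Bessel for the rows of an orthonormal pair.**  For `e ∈ kerSpan` and orthonormal `h, k ∈ V8`,
`Σ_v (|⟪rowVec h v, e⟫|² + |⟪rowVec k v, e⟫|²) ≤ ‖e‖² / 2`: the four vectors `h ⊗ δ_v, k ⊗ δ_v` are
orthonormal in the block space, and the block of `e` carries half of `‖e‖²`. [folklore] -/
theorem sum_norm_sq_inner_rowVec_le {e : V64} (he : e ∈ kerSpan) {h k : V8} (h1 : ‖h‖ = 1)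
    (k1 : ‖k‖ = 1) (hk : ⟪h, k⟫_ℂ = 0) :
    (∑ v : Fin 2, (‖⟪rowVec h v, e⟫_ℂ‖ ^ 2 + ‖⟪rowVec k v, e⟫_ℂ‖ ^ 2)) ≤ ‖e‖ ^ 2 / 2 := by
  -- the orthonormal family `f (i, v) = b_i ⊗ δ_v`
  let bb : Fin 2 → V8 := ![h, k]
  let f : Fin 2 × Fin 2 → EuclideanSpace ℂ ((Fin 2 × P2) × Fin 2) := fun iv =>
    WithLp.toLp 2 fun t => if t.2 = iv.2 then bb iv.1 t.1 else 0
  let g : EuclideanSpace ℂ ((Fin 2 × P2) × Fin 2) :=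
    WithLp.toLp 2 fun t => e (((0, t.1.1), t.1.2), (1, t.2))
  have hbb : ∀ i i' : Fin 2, ⟪bb i, bb i'⟫_ℂ = if i = i' then 1 else 0 := by
    have hh : ⟪h, h⟫_ℂ = 1 := by
      have h1' : ((‖h‖ : ℝ) : ℂ) ^ 2 = 1 := by rw [h1]; norm_num
      rw [inner_self_eq_norm_sq_to_K]
      exact h1'
    have hkk : ⟪k, k⟫_ℂ = 1 := by
      have k1' : ((‖k‖ : ℝ) : ℂ) ^ 2 = 1 := by rw [k1]; norm_num
      rw [inner_self_eq_norm_sq_to_K]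
      exact k1'
    have hkh : ⟪k, h⟫_ℂ = 0 := by rw [← inner_conj_symm, hk, map_zero]
    intro i i'
    fin_cases i <;> fin_cases i'
    · show ⟪h, h⟫_ℂ = _
      rw [if_pos rfl]; exact hh
    · show ⟪h, k⟫_ℂ = _
      rw [if_neg (by decide)]; exact hk
    · show ⟪k, h⟫_ℂ = _
      rw [if_neg (by decide)]; exact hkh
    · show ⟪k, k⟫_ℂ = _
      rw [if_pos rfl]; exact hkk
  have hf : Orthonormal ℂ f := by
    rw [orthonormal_iff_ite]
    rintro ⟨i, v⟩ ⟨i', v'⟩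
    rw [PiLp.inner_apply, Fintype.sum_prod_type_right]
    by_cases hv : v = v'
    · subst hv
      rw [Finset.sum_eq_single v]
      · have h2 : (∑ q : Fin 2 × P2, ⟪f (i, v) (q, v), f (i', v) (q, v)⟫_ℂ) = ⟪bb i, bb i'⟫_ℂ := by
          rw [inner_V8]
          refine Finset.sum_congr rfl fun q _ => ?_
          simp [f, mul_comm]
        rw [h2, hbb]
        by_cases hi : i = i'
        · subst hi; simp
        · rw [if_neg hi, if_neg (fun h' => hi (Prod.ext_iff.1 h').1)]
      · intro w _ hw
        refine Finset.sum_eq_zero fun q _ => ?_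
        simp [f, hw]
      · intro h'; exact absurd (Finset.mem_univ _) h'
    · rw [if_neg (fun h' => hv (Prod.ext_iff.1 h').2)]
      refine Finset.sum_eq_zero fun w _ => Finset.sum_eq_zero fun q _ => ?_
      simp only [f, RCLike.inner_apply]
      by_cases hw : w = v
      · have hw' : w ≠ v' := fun h' => hv (hw.symm.trans h')
        rw [if_neg hw', zero_mul]
      · rw [if_neg hw, map_zero, mul_zero]
  -- Bessel
  have hB := hf.sum_inner_products_le g (s := Finset.univ)
  -- the block of `e` carries half of its mass
  have hg : ‖g‖ ^ 2 = ‖e‖ ^ 2 / 2 := by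
    rw [← kerSpan_half_norm_sq he, EuclideanSpace.norm_sq_eq]
    simp only [Fintype.sum_prod_type, g]
  -- identify the terms
  have hterm : ∀ (i v : Fin 2), ⟪f (i, v), g⟫_ℂ = ⟪rowVec (bb i) v, e⟫_ℂ := by
    intro i v
    rw [inner_rowVec_eq_block]
  rw [← hg]
  refine le_trans (le_of_eq ?_) hB
  rw [Fintype.sum_prod_type, Fin.sum_univ_two, Fin.sum_univ_two, Fin.sum_univ_two, Fin.sum_univ_two]
  simp only [hterm]
  simp only [bb, Matrix.cons_val_zero, Matrix.cons_val_one]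
  ring

/-! ## Lemma R: a `6`-plane of the kernel captures a third of the rows of an orthonormal pair -/

/-- `dim kerSpan = 8`. [folklore] -/
theorem finrank_kerSpan : finrank ℂ kerSpan = 8 := by
  have hli : LinearIndependent ℂ kerVec := by
    refine linearIndependent_of_ne_zero_of_inner_eq_zero kerVec_ne_zero ?_
    intro a b hab
    change ⟪kerVec a, kerVec b⟫_ℂ = 0
    rw [inner_kerVec_kerVec, if_neg hab]
  rw [kerSpan, finrank_span_eq_card hli]
  simp

/-- **Lemma R (the structural certificate, quantitative core).**  Let `Y ≤ kerSpan` be a subspace of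
dimension `≥ 6` and `h, k` an orthonormal pair of traceless elements of `V8` (`sl(V) ⊗ W*`).  Then
the orthogonal projection onto `Y` captures at least a third of the four rows of the pair:
`1/3 ≤ Σ_v (‖P_Y (rowVec h v)‖² + ‖P_Y (rowVec k v)‖²)`.
Proof: `kerProj = P_Y + P_E` with `E = Yᗮ ⊓ kerSpan` of dimension `≤ 2`; the rows have `kerProj`-mass
`2/3 + 2/3` (`sum_norm_sq_kerProj_rowVec`) and `P_E`-mass at most `(dim E)/2 ≤ 1` (Bessel,
`sum_norm_sq_inner_rowVec_le`, over an orthonormal basis of `E`).  Exactly: no `10`-plane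
`F ≤ K` with `K ⊖ F ∌ U ⊗ h` passes the `(210)` test. [folklore] -/
theorem third_le_sum_norm_sq_starProjection_rowVec {Y : Submodule ℂ V64} (hY : Y ≤ kerSpan)
    (hY6 : 6 ≤ finrank ℂ Y) {h k : V8} (hh : h ∈ traceless) (hkt : k ∈ traceless)
    (h1 : ‖h‖ = 1) (k1 : ‖k‖ = 1) (hk : ⟪h, k⟫_ℂ = 0) :
    (1 : ℝ) / 3 ≤ ∑ v : Fin 2, (‖Y.starProjection (rowVec h v)‖ ^ 2
      + ‖Y.starProjection (rowVec k v)‖ ^ 2) := by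
  -- the complement `E` of `Y` in `kerSpan`
  set E : Submodule ℂ V64 := Yᗮ ⊓ kerSpan with hEdef
  have hdim : finrank ℂ Y + finrank ℂ E = 8 := by
    rw [hEdef, Submodule.finrank_add_inf_finrank_orthogonal hY, finrank_kerSpan]
  have hE2 : finrank ℂ E ≤ 2 := by omega
  let bE := stdOrthonormalBasis ℂ E
  -- decomposition of `kerProj x`
  have hdec : ∀ x : V64, ‖kerProj x‖ ^ 2
      = ‖Y.starProjection x‖ ^ 2 + ∑ t, ‖⟪((bE t : E) : V64), x⟫_ℂ‖ ^ 2 := by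
    intro x
    set u : V64 := kerProj x - Y.starProjection x with hu
    have hPY : Y.starProjection x ∈ Y := Y.starProjection_apply_mem x
    have huK : u ∈ kerSpan := Submodule.sub_mem _ (kerProj_mem x) (hY hPY)
    have huY : u ∈ Yᗮ := by
      rw [Submodule.mem_orthogonal]
      intro y hy
      rw [hu, inner_sub_right, inner_kerProj_eq_of_mem (hY hy), ← Submodule.inner_starProjection_left_eq_right,
        Submodule.starProjection_eq_self_iff.2 hy, sub_self]
    have huE : u ∈ E := ⟨huY, huK⟩
    have horth : ⟪Y.starProjection x, u⟫_ℂ = 0 := Submodule.inner_right_of_mem_orthogonal hPY huY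
    have hsum : kerProj x = Y.starProjection x + u := by rw [hu]; abel
    have hpy := norm_add_sq_eq_norm_sq_add_norm_sq_of_inner_eq_zero _ _ horth
    rw [← hsum, ← pow_two, ← pow_two, ← pow_two] at hpy
    rw [hpy]
    congr 1
    -- Parseval in `E`
    have hP := bE.sum_sq_norm_inner_right ⟨u, huE⟩
    rw [show ‖u‖ = ‖(⟨u, huE⟩ : E)‖ from Submodule.norm_coe (⟨u, huE⟩ : E), ← hP]
    refine Finset.sum_congr rfl fun t _ => ?_
    rw [Submodule.coe_inner]
    congr 2
    -- `⟪bE t, u⟫ = ⟪bE t, x⟫`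
    have ht : ((bE t : E) : V64) ∈ E := (bE t).2
    change ⟪((bE t : E) : V64), u⟫_ℂ = ⟪((bE t : E) : V64), x⟫_ℂ
    rw [hu, inner_sub_right, inner_kerProj_eq_of_mem ht.2,
      Submodule.inner_left_of_mem_orthogonal hPY ht.1, sub_zero]
  -- captured mass of the rows
  have hrows : (∑ v : Fin 2, (‖kerProj (rowVec h v)‖ ^ 2 + ‖kerProj (rowVec k v)‖ ^ 2)) = 4 / 3 := by
    rw [Finset.sum_add_distrib, sum_norm_sq_kerProj_rowVec hh, sum_norm_sq_kerProj_rowVec hkt, h1, k1]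
    norm_num
  -- Bessel over the basis of `E`
  have hbes : (∑ t, ∑ v : Fin 2, (‖⟪((bE t : E) : V64), rowVec h v⟫_ℂ‖ ^ 2
      + ‖⟪((bE t : E) : V64), rowVec k v⟫_ℂ‖ ^ 2)) ≤ 1 := by
    have hle : ∀ t, (∑ v : Fin 2, (‖⟪((bE t : E) : V64), rowVec h v⟫_ℂ‖ ^ 2
        + ‖⟪((bE t : E) : V64), rowVec k v⟫_ℂ‖ ^ 2)) ≤ 1 / 2 := by
      intro t
      have ht : ((bE t : E) : V64) ∈ kerSpan := (bE t).2.2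
      have hn : ‖((bE t : E) : V64)‖ = 1 := by
        rw [Submodule.norm_coe]; exact bE.orthonormal.1 t
      have hB := sum_norm_sq_inner_rowVec_le ht h1 k1 hk
      rw [hn] at hB
      have hsym : ∀ (b : V8) (v : Fin 2), ‖⟪((bE t : E) : V64), rowVec b v⟫_ℂ‖ = ‖⟪rowVec b v, ((bE t : E) : V64)⟫_ℂ‖ := by
        intro b v; rw [← inner_conj_symm, Complex.norm_conj]
      simp only [hsym]
      linarith
    calc (∑ t, ∑ v : Fin 2, (‖⟪((bE t : E) : V64), rowVec h v⟫_ℂ‖ ^ 2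
          + ‖⟪((bE t : E) : V64), rowVec k v⟫_ℂ‖ ^ 2))
        ≤ ∑ _t : Fin (finrank ℂ E), (1 : ℝ) / 2 := Finset.sum_le_sum fun t _ => hle t
      _ = (finrank ℂ E : ℝ) / 2 := by simp [div_eq_mul_inv]
      _ ≤ 1 := by
          have : (finrank ℂ E : ℝ) ≤ 2 := by exact_mod_cast hE2
          linarith
  -- assemble
  have hsplit : (∑ v : Fin 2, (‖kerProj (rowVec h v)‖ ^ 2 + ‖kerProj (rowVec k v)‖ ^ 2))
      = (∑ v : Fin 2, (‖Y.starProjection (rowVec h v)‖ ^ 2 + ‖Y.starProjection (rowVec k v)‖ ^ 2))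
        + ∑ t, ∑ v : Fin 2, (‖⟪((bE t : E) : V64), rowVec h v⟫_ℂ‖ ^ 2
            + ‖⟪((bE t : E) : V64), rowVec k v⟫_ℂ‖ ^ 2) := by
    simp only [hdec]
    rw [Finset.sum_comm (s := Finset.univ) (t := Finset.univ)]
    simp only [Finset.sum_add_distrib]
    ring
  linarith [hrows, hbes, hsplit]

end Summit.MatrixMultiplication.MatrixMultiplication.Theorems.GapTwoSixExplicit

end
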